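import Mathlib.Combinatorics.SetFamily.FourFunctions
import Mathlib.Tactic
import HarnessLib
import HarnessLib.Audit.Tags
import Summits.CriticalPhenomena.PercolationContinuityZ3.Theorems.PercNearOneGluingNoHeavyLowerTailSahiColouredDaykin
import Summits.CriticalPhenomena.PercolationContinuityZ3.Theorems.PercNearOneGluingNoHeavyLowerTailSahiColouredDaykinTwoColours
import Summits.CriticalPhenomena.PercolationContinuityZ3.Theorems.PercNearOneGluingNoHeavyLowerTailSahiColouredDaykinCross
import Summits.CriticalPhenomena.PercolationContinuityZ3.Theorems.PercNearOneGluingNoHeavyLowerTailSahiMSEquality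

/-!
# `NoHeavyLowerTail` (crux stmt-CriticalPhenomena-4575), master-family line P1 (gen 31):
# cross meets and complemented cross joins already pay — conjecture MJ and the reduction `MJ ⟹ CrossSignedColouredDaykin3`

Support file (seat `prim-masterthm-p1`, gen 31; `--supports stmt-CriticalPhenomena-4575`).  Two definitions (`crossColMeets`,
`crossColCoJoins`), one typed conjecture (`CrossMeetJoin`), no `sorry`, standard axioms.  Memo
`run/shared/lean/prim/prim-masterthm/FROM-prim-masterthm-p1-g31-RECONCILIATION-AND-MJ.md` §2.

CONTEXT.  `CrossSignedColouredDaykin3` (`…SahiColouredDaykinCross`, = TwistedAD's three-label Marica–Schönheim (AMS-3) restricted to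
crossing configurations) is all the three-petal refined antipodal Gladkov count needs (`card_crossPairs₃_le_card_payPairs₃_of_cross`).
For a crossing configuration `P` with 3-colouring `c` the family `(compatJoins F P c)ᶜ` consists of the within-colour differences
`S \ T`, the cross-colour meets `S ∩ T` and the complemented cross-colour joins `F \ (S ∪ T)`.

NEW (gen 31).
* **CONJECTURE MJ (`CrossMeetJoin`, typed).**  If `P ⊆ 2^F` is crossing (any two members meet and do not cover `F`, members of
  different colours are incomparable) and EVERY colour class has at least two members, then already the cross-colour meets together
  with the complemented cross-colour joins are at least as numerous as `P`:  `#P ≤ #(crossColMeets P c ∪ crossColCoJoins F P c)` —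
  the within-colour differences are not needed.  EVIDENCE: exhaustive over all 447 151 200 crossing three-colour configurations of
  `2^6` (171 431 280 + 23 188 800 + 1 680 of them have all classes of size ≥ 2, 3, 4): 0 violations, minimum margin 0, attained exactly
  at the "block configurations with complement-closed petal families" (e.g. `{013,023 | 124,125 | 045,345}`); exhaustive `2^4, 2^5`;
  annealing on `2^7, 2^8` (kit j249182).  The hypothesis "all classes ≥ 2" is necessary from `2^7` on (margin −2 occurs with a singleton
  class); on `2^≤6` the inequality even holds without it.
* `compl_mem_compatJoins_of_mem_union` / `card_union_le_card_compatJoins`: complements of MJ's family are compatible unions, so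
  `#(crossColMeets ∪ crossColCoJoins) ≤ #compatJoins`.
* **`crossSignedColouredDaykin3_of_crossMeetJoin` : `CrossMeetJoin α → CrossSignedColouredDaykin3 α`** — the singleton-class case is
  the unconditional `…SahiMSEquality.card_le_card_compatJoins_cross_of_singleton'` (gen 29, MS⁺), a missing colour is
  `card_le_card_compatJoins_of_ne` (gen 28, Daykin after re-signing), and the remaining case (all classes ≥ 2) is exactly MJ.
* `card_crossPairs₃_le_card_payPairs₃_of_crossMeetJoin`: hence MJ implies the refined antipodal Gladkov count for every three-petal
  system of up-sets in every sub-cube.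
HONEST FRAMING: a new, census-sharp typed conjecture and a kernel reduction; MJ and `CrossSignedColouredDaykin3` remain OPEN. [this work]
-/

namespace Summit.CriticalPhenomena.PercolationContinuityZ3.Theorems.SahiColouredDaykin

open Finset
open scoped FinsetFamily

variable {α : Type*} [DecidableEq α]

/-! ### 1. Cross-colour meets and complemented cross-colour joins; the conjecture -/

/-- Cross-colour meets `{S ∩ T : S, T ∈ P, c S ≠ c T}`. [this work] -/
def crossColMeets (P : Finset (Finset α)) (c : Finset α → Fin 3) : Finset (Finset α) :=
  ((P ×ˢ P).filter fun p => c p.1 ≠ c p.2).image fun p => p.1 ∩ p.2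

/-- Complemented cross-colour joins `{F \ (S ∪ T) : S, T ∈ P, c S ≠ c T}`. [this work] -/
def crossColCoJoins (F : Finset α) (P : Finset (Finset α)) (c : Finset α → Fin 3) : Finset (Finset α) :=
  ((P ×ˢ P).filter fun p => c p.1 ≠ c p.2).image fun p => F \ (p.1 ∪ p.2)

/-- Membership in the cross-colour meets. [this work] -/
theorem inter_mem_crossColMeets {P : Finset (Finset α)} {c : Finset α → Fin 3} {S T : Finset α}
    (hS : S ∈ P) (hT : T ∈ P) (hc : c S ≠ c T) : S ∩ T ∈ crossColMeets P c :=
  mem_image.2 ⟨(S, T), mem_filter.2 ⟨mem_product.2 ⟨hS, hT⟩, hc⟩, rfl⟩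

/-- Membership in the complemented cross-colour joins. [this work] -/
theorem sdiff_union_mem_crossColCoJoins {F : Finset α} {P : Finset (Finset α)} {c : Finset α → Fin 3} {S T : Finset α}
    (hS : S ∈ P) (hT : T ∈ P) (hc : c S ≠ c T) : F \ (S ∪ T) ∈ crossColCoJoins F P c :=
  mem_image.2 ⟨(S, T), mem_filter.2 ⟨mem_product.2 ⟨hS, hT⟩, hc⟩, rfl⟩

/-- **CONJECTURE MJ (cross meets and complemented cross joins pay; typed).**  For a crossing configuration in which every colour
class has at least two members, `#P ≤ #(crossColMeets P c ∪ crossColCoJoins F P c)`.  Exhaustive on `2^n`, `n ≤ 6` (447 151 200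
crossing three-colour configurations of `2^6`, minimum margin 0); the size hypothesis is necessary from `2^7` on. [this work] [status: open] -/
@[conjecture] def CrossMeetJoin (α : Type*) [DecidableEq α] : Prop :=
  ∀ (F : Finset α) (P : Finset (Finset α)) (c : Finset α → Fin 3),
    (∀ S ∈ P, S ⊆ F) →
    (∀ S ∈ P, ∀ T ∈ P, c S ≠ c T → ¬ S ⊆ T) →
    (∀ S ∈ P, ∀ T ∈ P, (S ∩ T).Nonempty ∧ S ∪ T ≠ F) →
    (∀ i : Fin 3, 2 ≤ #(P.filter fun S => c S = i)) →
    #P ≤ #(crossColMeets P c ∪ crossColCoJoins F P c)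

/-! ### 2. Complements of MJ's family are compatible unions -/

/-- The complement in `F` of a cross-colour meet or of a complemented cross-colour join is a compatible union. [this work] -/
theorem compl_mem_compatJoins_of_mem_union {F : Finset α} {P : Finset (Finset α)} {c : Finset α → Fin 3}
    (hPF : ∀ S ∈ P, S ⊆ F) {X : Finset α} (hX : X ∈ crossColMeets P c ∪ crossColCoJoins F P c) :
    F \ X ∈ compatJoins F P c := by
  rcases mem_union.1 hX with hX | hX
  · obtain ⟨⟨S, T⟩, hST, rfl⟩ := mem_image.1 hX
    obtain ⟨hmem, hc⟩ := mem_filter.1 hST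
    obtain ⟨hS, hT⟩ := mem_product.1 hmem
    have : F \ (S ∩ T) = (F \ S) ∪ (F \ T) := sdiff_inter_distrib_right F S T
    rw [this]
    exact sdiff_union_sdiff_mem_compatJoins hS hT hc
  · obtain ⟨⟨S, T⟩, hST, rfl⟩ := mem_image.1 hX
    obtain ⟨hmem, hc⟩ := mem_filter.1 hST
    obtain ⟨hS, hT⟩ := mem_product.1 hmem
    have : F \ (F \ (S ∪ T)) = S ∪ T := Finset.sdiff_sdiff_eq_self (union_subset (hPF S hS) (hPF T hT))
    rw [this]
    exact union_mem_compatJoins hS hT hc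

/-- Hence MJ's family is at most as large as the family of compatible unions. [this work] -/
theorem card_union_le_card_compatJoins (F : Finset α) (P : Finset (Finset α)) (c : Finset α → Fin 3)
    (hPF : ∀ S ∈ P, S ⊆ F) :
    #(crossColMeets P c ∪ crossColCoJoins F P c) ≤ #(compatJoins F P c) := by
  have hsubF : ∀ X ∈ crossColMeets P c ∪ crossColCoJoins F P c, X ⊆ F := by
    intro X hX
    rcases mem_union.1 hX with hX | hX
    · obtain ⟨⟨S, T⟩, hST, rfl⟩ := mem_image.1 hX
      obtain ⟨hmem, _⟩ := mem_filter.1 hST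
      obtain ⟨hS, _⟩ := mem_product.1 hmem
      exact inter_subset_left.trans (hPF S hS)
    · obtain ⟨⟨S, T⟩, _, rfl⟩ := mem_image.1 hX
      exact sdiff_subset
  calc #(crossColMeets P c ∪ crossColCoJoins F P c)
      = #((crossColMeets P c ∪ crossColCoJoins F P c).image fun X => F \ X) := by
        refine (card_image_of_injOn ?_).symm
        intro X hX Y hY hXY
        have hX' := hsubF X (mem_coe.1 hX)
        have hY' := hsubF Y (mem_coe.1 hY)
        have hXY' : F \ X = F \ Y := hXY
        calc X = F \ (F \ X) := (Finset.sdiff_sdiff_eq_self hX').symm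
          _ = F \ (F \ Y) := by rw [hXY']
          _ = Y := Finset.sdiff_sdiff_eq_self hY'
    _ ≤ #(compatJoins F P c) := by
        refine card_le_card ?_
        intro Y hY
        obtain ⟨X, hX, rfl⟩ := mem_image.1 hY
        exact compl_mem_compatJoins_of_mem_union hPF hX

/-! ### 3. The reduction `MJ ⟹ CrossSignedColouredDaykin3` -/

/-- **`CrossMeetJoin ⟹ CrossSignedColouredDaykin3`.**  A missing colour is Daykin after re-signing (`card_le_card_compatJoins_of_ne`),
a singleton colour class is the unconditional MS⁺ case (`…SahiMSEquality.card_le_card_compatJoins_cross_of_singleton'`), and when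
every class has at least two members MJ applies. [this work] -/
theorem crossSignedColouredDaykin3_of_crossMeetJoin (h : CrossMeetJoin α) : CrossSignedColouredDaykin3 α := by
  intro F P c hPF hinc hcross
  -- no complementary pair in a crossing configuration
  have htr : ∀ S ∈ P, F \ S ∉ P := by
    intro S hS hS'
    have hne := (hcross S hS (F \ S) hS').1
    rw [inter_sdiff_self] at hne
    exact Finset.not_nonempty_empty hne
  by_cases hall : ∀ j : Fin 3, ∃ S ∈ P, c S = j
  · by_cases htwo : ∀ i : Fin 3, 2 ≤ #(P.filter fun S => c S = i)
    · exact (h F P c hPF hinc hcross htwo).trans (card_union_le_card_compatJoins F P c hPF)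
    · obtain ⟨i, hi⟩ := not_forall.1 htwo
      have hlt : #(P.filter fun S => c S = i) < 2 := not_le.1 hi
      have hpos : 0 < #(P.filter fun S => c S = i) := by
        obtain ⟨S, hS, hSi⟩ := hall i
        exact card_pos.2 ⟨S, mem_filter.2 ⟨hS, hSi⟩⟩
      have hone : #(P.filter fun S => c S = i) = 1 := by omega
      exact SahiMSEquality.card_le_card_compatJoins_cross_of_singleton' F P c i hPF hcross hone hall
  · obtain ⟨a, ha⟩ := not_forall.1 hall
    have ha' : ∀ S ∈ P, c S ≠ a := fun S hS hSa => ha ⟨S, hS, hSa⟩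
    exact card_le_card_compatJoins_of_ne F P c a hPF htr ha'

/-- **MJ ⟹ the refined antipodal Gladkov count for three petals**, in every sub-cube. [this work] -/
theorem card_crossPairs₃_le_card_payPairs₃_of_crossMeetJoin (h : CrossMeetJoin α)
    {U : Fin 3 → Finset (Finset α)} {K : Finset (Finset α)}
    (hU : ∀ i, IsUpperSet (U i : Set (Finset α))) (hK : ∀ i j, i ≠ j → U i ∩ U j = K) (B F : Finset α) :
    #(crossPairs₃ (fun i => U i \ K) B F) ≤ #(payPairs₃ (fun i => U i \ K) B F) :=
  card_crossPairs₃_le_card_payPairs₃_of_cross (crossSignedColouredDaykin3_of_crossMeetJoin h) hU hK B F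



end Summit.CriticalPhenomena.PercolationContinuityZ3.Theorems.SahiColouredDaykin
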